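import Mathlib
import Summits.Ventures.DiscreteObjects.MOLS.SelfOrthogonalPairs

/-!
# Pair arrays: an automorphism fixing a coordinate of a rigid coordinate-triple is trivial

Cell `pub-namedobj`, target (M), family SOLS — the bookkeeping step (a) of FAMILY-SOLS §1, typed.
Framing: lottery ticket; floor = certified bounds/negative ranges.

A *strength-2 array* on a coordinate type `ι` with values in `α` is a set `T` of rows `ι → α` such
that for any two distinct coordinates `i ≠ j` and values `a, b` exactly one row has `t i = a, t j = b`
(`IsOA2`; the orthogonal array of a pair of orthogonal Latin squares is the case `ι = Fin 4`, that of a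
triple `ι = Fin 5`). A symmetry `(π, φ)` — a permutation `π` of the coordinates and a value
permutation `φ i` on each coordinate — acts on rows by `(act π φ t) (π i) = φ i (t i)`; it is an
*automorphism* of `T` when it maps `T` onto itself (`IsArrayAut`).

`RigidAwayFrom T k` says: every symmetry fixing the coordinate `k` that maps the projection of `T`
to the other coordinates into itself is trivial on those coordinates. For the pair array of two
orthogonal Latin squares of order 10 inside a triple this is exactly what [McKay–Meynert–Myrvold
2007] provides: the projection to three coordinates is (the triple set of) a Latin square lying in a
set of three MOLS, whose autoparatopy group is trivial. The theorem `arrayAut_eq_one_of_fix` then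
says that an automorphism of `T` whose coordinate part fixes `k` is the identity — so a non-trivial
automorphism group of such a pair array consists of symmetries with fixed-point-free coordinate part,
which is where `perm_fin4_eq_one_or_derangement` / `fin4_derangement_sq` (SelfOrthogonalPairs) take
over. Nothing published is assumed; [MMM 2007] enters only through the hypothesis `RigidAwayFrom`.
-/

namespace Summit.Ventures.DiscreteObjects.MOLS

variable {ι α : Type*}

/-- Strength 2: any two distinct coordinates and any two values determine exactly one row. -/
def IsOA2 (T : Set (ι → α)) : Prop :=
  ∀ i j : ι, i ≠ j → ∀ a b : α, ∃! t, t ∈ T ∧ t i = a ∧ t j = b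

/-- The action of a symmetry `(π, φ)` on rows: the new row carries `φ i (t i)` in position `π i`. -/
def act (π : Equiv.Perm ι) (φ : ι → Equiv.Perm α) (t : ι → α) : ι → α :=
  fun j => φ (π.symm j) (t (π.symm j))

/-- Value of the acted row in position `π i`. -/
theorem act_apply_perm (π : Equiv.Perm ι) (φ : ι → Equiv.Perm α) (t : ι → α) (i : ι) :
    act π φ t (π i) = φ i (t i) := by
  simp [act]

/-- `(π, φ)` is an automorphism of the array `T`: it maps `T` onto `T`. -/
def IsArrayAut (T : Set (ι → α)) (π : Equiv.Perm ι) (φ : ι → Equiv.Perm α) : Prop :=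
  ∀ t, t ∈ T ↔ act π φ t ∈ T

/-- Rigidity of the projection away from `k` (the [MMM 2007] input at order 10): a symmetry fixing the
coordinate `k` that maps the projection of `T` to the coordinates `≠ k` into itself acts trivially on
those coordinates. -/
def RigidAwayFrom (T : Set (ι → α)) (k : ι) : Prop :=
  ∀ (π : Equiv.Perm ι) (φ : ι → Equiv.Perm α), π k = k →
    (∀ t ∈ T, ∃ s ∈ T, ∀ j, j ≠ k → act π φ t j = s j) →
      (∀ j, j ≠ k → π j = j) ∧ (∀ j, j ≠ k → φ j = 1)

/-- **Step (a).** Let `T` be a strength-2 array with at least three coordinates (`j₁, j₂, k`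
pairwise distinct). If the projection away from `k` is rigid, then every automorphism of `T` whose
coordinate permutation fixes `k` is trivial: `π = 1` and all `φ i = 1` (the value map on `k` is forced
because a row is determined by its entries in `j₁, j₂`). -/
theorem arrayAut_eq_one_of_fix {T : Set (ι → α)} (hT : IsOA2 T) {k j₁ j₂ : ι}
    (h₁ : j₁ ≠ k) (h₂ : j₂ ≠ k) (h₁₂ : j₁ ≠ j₂) (hrig : RigidAwayFrom T k)
    {π : Equiv.Perm ι} {φ : ι → Equiv.Perm α} (haut : IsArrayAut T π φ) (hk : π k = k) :
    π = 1 ∧ ∀ i, φ i = 1 := by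
  -- the automorphism maps the projection into itself
  have hproj : ∀ t ∈ T, ∃ s ∈ T, ∀ j, j ≠ k → act π φ t j = s j :=
    fun t ht => ⟨act π φ t, (haut t).1 ht, fun _ _ => rfl⟩
  obtain ⟨hπ, hφ⟩ := hrig π φ hk hproj
  have hπ1 : π = 1 := by
    ext j
    by_cases hj : j = k
    · subst hj; simpa using hk
    · simpa using hπ j hj
  refine ⟨hπ1, fun i => ?_⟩
  by_cases hi : i = k
  · subst hi
    -- φ i fixes every value: take a row through an arbitrary value a in coordinate i
    ext a
    obtain ⟨t, ⟨ht, hti, -⟩, -⟩ := hT i j₁ (Ne.symm h₁) a (a)  -- some row with t i = a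
    -- act t ∈ T agrees with t on j₁ and j₂
    have hat : act π φ t ∈ T := (haut t).1 ht
    have e1 : act π φ t j₁ = t j₁ := by
      have := act_apply_perm π φ t j₁
      rw [hπ1] at this ⊢; simp only [Equiv.Perm.coe_one, id_eq] at this
      rw [this, hφ j₁ h₁]; simp
    have e2 : act π φ t j₂ = t j₂ := by
      have := act_apply_perm π φ t j₂
      rw [hπ1] at this ⊢; simp only [Equiv.Perm.coe_one, id_eq] at this
      rw [this, hφ j₂ h₂]; simp
    -- uniqueness of the row with these two entries
    obtain ⟨u, -, huniq⟩ := hT j₁ j₂ h₁₂ (t j₁) (t j₂)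
    have hu1 : act π φ t = u := huniq _ ⟨hat, e1, e2⟩
    have hu2 : t = u := huniq _ ⟨ht, rfl, rfl⟩
    have hrow : act π φ t = t := hu1.trans hu2.symm
    have hai : act π φ t i = φ i (t i) := by
      have := act_apply_perm π φ t i
      rwa [hk] at this
    have := congrFun hrow i
    rw [hai, hti] at this
    simpa using this
  · exact hφ i hi

end Summit.Ventures.DiscreteObjects.MOLS
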